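import Summits.QuantumFields.YangMills.Theorems.BalabanUVNodesN07AtRecordCritPinned
import Literature.MathematicalPhysics.QuantumFieldTheory.Balaban1983to89.Node00.Record12CarriersRecords

/-!
# BalabanUVNodes ∕ N07 ([Balaban1985Variational], `Dag.B11_main`) AT THE STAGE-12 RECORD OF RECORD — the ₁₂ storey of N07's census line: the stub
# `YMDAG.UVSplit.S_N07 Rec := AtRecord Rec Dag.B11_main` READ, its keyed closers, the COMPOSABLE FACE for the K1′ knit, THE ∃-CURRENCY RE-KEYED (the located
# fix of dag-ref-C READ #122's A1 (p₁₁) vacuity) and the census ∕ guards — at node00-def g32∕g33's four-pin key `Node00.IsRecordOfRecord₁₂CB10YZW` over def-T's repaired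
# `Node00/Record12` (a ₁₂C record: SAME datum, SAME world; R457's repair lane: the level-0 background pinned BY VALUE, the §2 [III] format of record)

Track A of `YM-PLAN.md` (cell `pub-ymgap`, HUMAN RULING D-0062), DAG node **N07** = [Balaban1985Variational] T. Bałaban, *The variational problem and background fields
in renormalization group method for lattice gauge theories*, Commun. Math. Phys. **102** (1985) 277–309: Thm 1 p. 279 + Props 2–9 pp. 281–309; R141 (C) seat
`pub-ymgap-dag-n07-e` (generation 3; FAN-OUT v1.1 §N07 row s3 «repaired-tower currency», continuation).

WHY THIS FILE.  dag-ref-C READ #122 (pub-ymgap INBOX l.13702) LOCATED on this seat's `BalabanUVNodesN07AtRecordCritPinned` (p465289) — and thereby on every ₁₁ ∃-consumer of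
the N07 lineage (`N07AtRecord11.exists_record₁₁CB10YZW_…` p450629, `N07AtRecordTwoTier.exists_record₁₁CB10YZW_b11_main_of_leaf` p455032, `…_noLoc` p456450 ∕ p458798) —
the A1 VACUITY (p₁₁): their binder `(θ : Stage11Params F N) (h : θ.Provisos₁₁)` is UNINHABITED by def-T's `Node00.not_provisos₁₁` (`Record12` :572; the field `alphaPos` at the
run `⟨0, 0, 0⟩` reads `0 < α(0) = 0`) and their conclusion `∃ w, IsRecordOfRecord₁₁CB10YZW … w ∧ …` is FALSE at every datum (`Node00.not_isRecordOfRecord₁₁C`) — the theorems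
hold ex falso.  THE FIX OF RECORD (ref-C: «re-key the three to ₁₂ once g32 C2 lands»): this module RE-RUNS the ₁₁ storey `11 ↦ 12` on node00-def g32's
`Node00/Record12Carriers` (p459372: `Stage12Params.view₁₂B10YZW`, `upOfRecord₅C_view₁₂B10YZW_leaves`, `Stage12Params.rebindX`, `Provisos₁₂.rebindX`, `datumOfRecord₁₂_rebindX`)
and g33's `Node00/Record12CarriersRecords` (p466349: `IsRecordOfRecord₁₂CB10YZW`, `atWorld_of_…`, `leaves_iff_of_…`, `isRecordOfRecord₁₂C_of_…`,
`isRecordOfRecord₁₂CB10YZW_rebind_of_isRecordOfRecord₁₂C`) over def-T's `Node00/Record12` v2.2 (`Stage12Params`, `Provisos₁₂`, `datumOfRecord₁₂`, `IsRecordOfRecord₁₂C`,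
`exists_world_isRecordOfRecord₁₂C`).  AT ₁₂ THE BINDER `(θ : Stage12Params F N) (h : θ.Provisos₁₂ F N) (hθ : θ.Admissible F N)` IS THE ROUTE's K0′ `Record12Inhabited`
(stmt-QuantumFields-19789, OPEN — neither proved nor refuted in the tree: `Provisos₁₂` drops the uninhabitable `alphaPos` (a theorem in the window, `alphaPos₁₂_of_window`) and guards
`bg` by the coupling window; the [III] induction base `k = 0` is a THEOREM at ₁₂, `Node00.inductionBase_datumOfRecord₁₂`), so the ∃-currency below speaks about REAL runs modulo
K0′ and is no longer ex falso.  `datumOfRecord₁₂` differs from `datumOfRecord₁₁` (the level-0 background), so — exactly as ₁₁ ↛ ₁₀ — the ₁₁ storey is not transported: its one-line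
recipes are RE-RUN on the ₁₂ faces (n08-c's `BalabanUVNodesN08AtRecord12` precedent, p466715).  CONTENT consumed BY NAME, nothing restated: the leaf-level theorems of this lineage
(`N07AtRecordCritPinned.b11Leaf_Z11OfRecord_pinCrit_of_prop7_leaves ∕ _pinCrit_of_towerT_parts ∕ _withSectE_pinCrit_of_parts ∕ _withSectE_pinCrit_of_towerT_parts_kappa_one`,
p465289 — record-free, untouched by (p₁₁)), g30's `Node00/CarriersZ` (`ResidZ`, `Z11OfRecord`, `G8a_of_b11Leaf_Z11OfRecord`, `exists_residZ_not_b11Leaf`), n07-a's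
`B11LeafUnpinnedRecord` (`b11_main_iff_of_isRecordOfRecord₅C`, `upOfRecord₅C_b8_b9_b11`, `b8LeafR_of_isEmpty`), n22-b's `N06AtRecord9CB10Y.exists_junkOps_b9LeafX_Y9OfRecord`.
THEOREMS ONLY (0 `def`, 0 `sorry`, 0 `instance`, standard axioms); COUNT-NEUTRAL; filed `--supports stmt-QuantumFields-19790 --as helper` (K1′ `StabilityBAtRecordR12e` of route
«BalabanUVNodes» rev 13∕14 — the (B)-side crux at ₁₂; a helper link, not a stub body: K1′'s registered `stub_nodes12` wants N01–N13 at SOME Stage-12 record `(θ, h, w)`; §2's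
`b11_main_at_view₁₂B10YZW_of_leaf` is the N07 face a knitter applies at the common world, §3's ∃-forms are N07 ALONE).

THE STUB AT THESE RECORDS.  At a ₁₂CB10YZW record `Dag.B11_main ℓ := b5 → b6 → b7 → b8 → b9 → b11` has `b4 b5 b6 b7` theorems of the record (N01–N04 at the Stage-5 shadow),
`b9` def-Y's leaf at a RESIDUAL operator layer `ops`, `b8` the RESIDUAL [B8] group's world leaf (unpinned here), `b11 = B11Leaf (Z11OfRecord F N ζ)` for the presenting [B11] layer `ζ`.
* §1 READINGS: `b11_main_iff_leaves_of_isRecordOfRecord₁₂CB10YZW` (N07 ⟺ «b8 → b9 → b11»), `G8a_of_leaf_b11_of_isRecordOfRecord₁₂CB10YZW` (what the leaf feeds def-B's Stage-₈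
  letters), `s_N07_iff_leaves₁₂CB10YZW`.
* §2 KEYED CLOSERS BY NAME: **`b11_main_at_view₁₂B10YZW_of_leaf`** (THE COMPOSABLE FACE: ANY world bound to the four-pin Stage-12 view presenting `ζ`, the leaf at `ζ` ⇒
  `Dag.B11_main` at every run — what a K1′ knitter applies at the ONE world carrying all thirteen nodes), `b11_main_of_isRecordOfRecord₁₂CB10YZW_of_slot` (g33's `_of_slots` idiom,
  N07 alone), `s_N07_record₁₂CB10YZW_of_leafSlot ∕ _of_bundleSlot` (§4: the bundle hypothesis is refutable — the ∀-form is NOT a target), `s_N07_of_refines₁₂CB10YZW_of_leaf`,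
  `s_N07_of_presented₁₂CB10YZW_of_leaf` (REPAIR SHAPES one storey up), `G8a_of_s_N07_refines₁₂CB10YZW`.
* §3 THE ∃-CURRENCY AT ₁₂ (THE LOCATED FIX): `exists_record₁₂CB10YZW_b11_main_of_leaf` (n07-d's recipe at ₁₂: every admissible Stage-12 `θ` with provisos and `γ > 0`, every floor,
  operator layer, [IV] layer, and a [B11] layer CARRYING THE LEAF ⇒ a ₁₂CB10YZW record over `datumOfRecord₁₂ θ h` at every run of which N07 HOLDS), and its four instances at the
  NAMED layers of this lineage — `…_pinCrit_of_prop7_leaves` (Props 2–7, 9 + r08's located leaves of Sect. F; NO `hloc`, NO `hcrit`), `…_pinCrit_of_towerT_parts` (the repaired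
  two-tier tower: Thm 1 and Prop 7 DERIVED from Props 2, 5, 6, 8, Sect. F + the located bridge steps), `…_withSectE_pinCrit_of_parts` (the doubly-pinned layer: seven printed
  statements, p4∕p6 theorems by node00-def-B11's `CarriersZSectE`), `…_withSectE_pinCrit_of_towerT_parts_kappa_one` (the printed tower κ₀ = 1 at the doubly-pinned layer: Props 2,
  3, 5, 8, Sect. F, Prop. 9 + bridge steps + constants) —, and **`exists_isRecordOfRecord₁₂C_b11_main_of_leaf`**: GIVEN ₁₂C-inhabitation at the family `F` (the route's K0′ at `F`,
  HYPOTHESIS) and the leaf at SOME residual layer, SOME ₁₂C record `(D, w′)` — the given datum, its world RE-BOUND by the four-pin view — carries `Dag.B11_main` at every run (K1′'s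
  ∃-form SERVED AT THE PIN for the N07 conjunct; n08-c's shape).
* §4 CENSUS ∕ GUARDS AT ₁₂CB10YZW (g33's docstring: «the ∀-forms stay junk-able as at ₁₁ (SAID)» — here CERTIFIED for N07): **`exists_record₁₂CB10YZW_faces`** (a record over `datumOfRecord₁₂ θ h` presented by GIVEN `ops`, `ζ`, `lamW` with the [B8] indices RE-BOUND EMPTY: `b8` VACUOUS, `b9 ⟺ B9LeafX
  (Y9OfRecord …)`, `b11 ⟺ B11Leaf (Z11OfRecord F N ζ)`), `b11Leaf_Z11OfRecord_of_s_N07_record₁₂CB10YZW` (the ∀-form forces the leaf at EVERY residual layer),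
  `thm1_family_of_s_N07_record₁₂CB10YZW`, **`not_s_N07_record₁₂CB10YZW_of_params`** (the ∀-form over the four-pin key is FALSE as soon as ONE admissible Stage-12 `θ` with provisos and
  `γ > 0` exists — i.e. MODULO K0′ — through g30's refuting layer `exists_residZ_not_b11Leaf`: the junk channel is the residual regularity datum `ζ.R`, F8, node00-def-B11 g3's row),
  `exists_record₁₂CB10YZW_not_b11_main`, `not_s_N07_record₁₂CB10YZW`, **`exists_record₁₂CB10YZW_b11_main_iff_leaf`** (at the junk-ops ∕ empty-[B8] presentation N07 IS EXACTLY the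
  leaf at the bundle of record — NOT junk-closable: its `t1` is Theorem 1 at NODE 00's objects over the inhabited `ZIdx`).
HONEST FRAMING.  Kernel bookkeeping BY NAME; NO estimate of [Balaban1985Variational] is proved here; Theorem 1 for `k ≥ 1` is proved NOWHERE in the tree (GAPS G₈a-1∕2; `k = 0`:
`B11Thm1CarrierTLevelZero`); every printed statement (Props 2–9, Sect. F), every located bridge step and r08's Sect.-F leaves stay DISPLAYED hypotheses of the §3 consumers, whose
∃-currency certifies that the displayed inputs CLOSE the node's own leaf at NODE 00's objects at a NAMED layer of a REAL Stage-12 run (modulo K0′) — NOT a discharge of N07 (junk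
in-edges `b8`, `b9` at the presenting world; 5∕27 untouched); object-level-unpinned in the [B11] group: `ζ.R` (F8), `famAn`.  One finite four-torus programme at fixed `ε` per run —
NOT ℝ⁴, NOT infinite volume, NOT OS, NOT a mass gap, NOT Clay.  Restate-immune (no `def`). -/

noncomputable section

namespace Summit.QuantumFields.YangMills.BalabanUVNodes.N07AtRecord12

open Literature.MathematicalPhysics.QuantumFieldTheory.Balaban1983to89
open Literature.MathematicalPhysics.QuantumFieldTheory.Balaban1983to89.T4Continuum (T4Family FiniteEpsData)
open Literature.MathematicalPhysics.QuantumFieldTheory.Balaban1983to89.DagBinding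
open Literature.MathematicalPhysics.QuantumFieldTheory.Balaban1983to89.Node00
open Literature.MathematicalPhysics.QuantumFieldTheory.Balaban1983to89.B11Thm1 (Thm1At)
open Literature.MathematicalPhysics.QuantumFieldTheory.Balaban1983to89.B11Thm1CarrierT (RegCarrierT varProblemT)
open Literature.MathematicalPhysics.QuantumFieldTheory.Balaban1983to89.B11Prop7Assembly (Bridge ExistenceLeavesCap)
open Literature.MathematicalPhysics.QuantumFieldTheory.Balaban1983to89.B11SectFAssembly (CubeData Leaves)
open YMDAG.UVSplit (RecordPred Datum AtRecord S_N07)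
open Summit.QuantumFields.YangMills.BalabanUVNodes.N06AtRecord9CB10Y (exists_junkOps_b9LeafX_Y9OfRecord)
open Summit.QuantumFields.YangMills.BalabanUVNodes.N07AtRecordCritPinned
  (b11Leaf_Z11OfRecord_pinCrit_of_prop7_leaves b11Leaf_Z11OfRecord_pinCrit_of_towerT_parts b11Leaf_Z11OfRecord_withSectE_pinCrit_of_parts
    b11Leaf_Z11OfRecord_withSectE_pinCrit_of_towerT_parts_kappa_one)
open scoped Matrix.Norms.L2Operator

variable {N : ℕ} [NeZero N] {F : T4Family} {D : FiniteEpsData F (Node00.SU N)} {w : WorldP}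

/-! ## §1 Readings at the four-pin Stage-12 record `IsRecordOfRecord₁₂CB10YZW` -/

/-- **At a ₁₂CB10YZW record N07 IS «b8 → b9 → b11»** (the in-edges `b4 b5 b6 b7` are theorems of the record: n07-a's `B11LeafUnpinnedRecord.b11_main_iff_of_isRecordOfRecord₅C`
along g33's `atWorld_of_isRecordOfRecord₁₂CB10YZW`). [cite: Balaban1985Variational, Thm 1 p.279, Props 2–9 pp.281–309 (bookkeeping: the node at a record)] -/
theorem b11_main_iff_leaves_of_isRecordOfRecord₁₂CB10YZW (h : IsRecordOfRecord₁₂CB10YZW F N D w) (P : B12.RunParams) :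
    Dag.B11_main (leavesP w P) ↔ ((leavesP w P).b8 → (leavesP w P).b9 → (leavesP w P).b11) :=
  atWorld_of_isRecordOfRecord₁₂CB10YZW (X := fun ℓ => Dag.B11_main ℓ ↔ (ℓ.b8 → ℓ.b9 → ℓ.b11))
    (fun _ _ h5 P => B11LeafUnpinnedRecord.b11_main_iff_of_isRecordOfRecord₅C h5 P) h P

/-- **WHAT N07's LEAF AT A ₁₂CB10YZW RECORD FEEDS THE STAGE-₈ LAYER** (the ₁₂ twin of g30's ₁₀ face `CarriersZ.G8a_of_b11Leaf_Z11OfRecord`): def-B's letters `UkExistsR ∧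
UniqueUkOrbitR F N (regB11 F N)` on every torus, level `k ≤ K`, radius `B₃ε₁`, `0 < ε₁ ≤ a₁`, every `V` with (7). [cite: Balaban1985Variational, Thm 1 p.279; Balaban1987RG1, (1.1)–(1.2) p.260] -/
theorem G8a_of_leaf_b11_of_isRecordOfRecord₁₂CB10YZW (h : IsRecordOfRecord₁₂CB10YZW F N D w) {P : B12.RunParams} (hb : (leavesP w P).b11) :
    ∃ C : B11Thm1.Consts, ∀ (K k : ℕ), k ≤ K → ∀ ε₁ : ℝ, 0 < ε₁ → ε₁ ≤ C.a₁ → ∀ V : GaugeField (F.P K) k (SU N), PlaqSmall ε₁ V →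
      UkExistsR F N (regB11 F N) K k (C.B₃ * ε₁) V ∧ UniqueUkOrbitR F N (regB11 F N) K k (C.B₃ * ε₁) V := by
  obtain ⟨θ, Mstar, ops, ζ, lamW, -, -, hl⟩ := leaves_iff_of_isRecordOfRecord₁₂CB10YZW h
  exact G8a_of_b11Leaf_Z11OfRecord (((hl P).2.2.2).1 hb)

/-- **`S_N07` over ₁₂CB10YZW IS «`b8 → b9 → b11` at every run of every record»**. [cite: Balaban1985Variational, Thm 1 p.279, Props 2–9 pp.281–309 (bookkeeping)] -/
theorem s_N07_iff_leaves₁₂CB10YZW : S_N07 (fun F D w => IsRecordOfRecord₁₂CB10YZW F N D w) ↔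
      ∀ (F : T4Family) (D : Datum F N) (w : WorldP), IsRecordOfRecord₁₂CB10YZW F N D w →
        ∀ P : B12.RunParams, (leavesP w P).b8 → (leavesP w P).b9 → (leavesP w P).b11 :=
  ⟨fun h F D w hR P => (b11_main_iff_leaves_of_isRecordOfRecord₁₂CB10YZW hR P).1 (h F D w hR P),
    fun h F D w hR P => (b11_main_iff_leaves_of_isRecordOfRecord₁₂CB10YZW hR P).2 (h F D w hR P)⟩

/-! ## §2 Keyed closers BY NAME — the composable face, the slot form, the repair shapes -/

/-- ★ **THE COMPOSABLE FACE FOR THE K1′ KNIT**: for ANY world `w` bound to the four-pin Stage-12 view presenting the operator layer `ops`, the [B11] layer `ζ` and the [IV] layer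
`lamW` (`w.up P = upOfRecord₅C (θ.view₁₂B10YZW Mstar ops ζ lamW) P`), the [B11] leaf at `Z11OfRecord F N ζ` gives `Dag.B11_main` at every run (in-edges unused) — what a knitter of
K1′'s `stub_nodes12` applies at the ONE world carrying all thirteen nodes (the ₁₂ twin of n07-d's `b11_main_at_view₁₁B10YZW_of_leaf`).
[cite: Balaban1985Variational, Thm 1 p.279, Props 2–9 pp.281–309 (bookkeeping: the node at the four-pin view)] -/
theorem b11_main_at_view₁₂B10YZW_of_leaf (θ : Stage12Params F N) (Mstar : ℕ) (ops : OpsY N θ.toStage3Params Mstar) (ζ : ResidZ F N)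
    (lamW : ResidW F N) (hup : ∀ P, w.up P = upOfRecord₅C F N (θ.view₁₂B10YZW F N Mstar ops ζ lamW) P)
    (hleaf : B11Leaf (Z11OfRecord F N ζ)) (P : B12.RunParams) : Dag.B11_main (leavesP w P) := by
  intro _ _ _ _ _
  show (w.up P).b11
  rw [hup P]
  exact (upOfRecord₅C_view₁₂B10YZW_leaves F N θ Mstar ops ζ lamW P).2.2.2.2 hleaf

/-- **N07 «SLOT» FORM at the four-pin Stage-12 key** (g33's `b9_b11_b15_main_of_isRecordOfRecord₁₂CB10YZW_of_slots` idiom, N07 ALONE): if the [B11] leaf holds at the bundle of record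
of EVERY parameter package presenting `(D, w)` — `hZ` quantifies over the HIDDEN package, honest —, then `Dag.B11_main` at every run. [cite: Balaban1985Variational, Thm 1 p.279, Props 2–9 pp.281–309 (the node's shape, bookkeeping)] -/
theorem b11_main_of_isRecordOfRecord₁₂CB10YZW_of_slot (h : IsRecordOfRecord₁₂CB10YZW F N D w)
    (hZ : ∀ (θ : Stage12Params F N) (hP : θ.Provisos₁₂ F N) (Mstar : ℕ) (ops : OpsY N θ.toStage3Params Mstar) (ζ : ResidZ F N) (lamW : ResidW F N),
      θ.Admissible F N → D = datumOfRecord₁₂ F N θ hP → (∀ P, w.up P = upOfRecord₅C F N (θ.view₁₂B10YZW F N Mstar ops ζ lamW) P) →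
        B11Leaf (Z11OfRecord F N ζ))
    (P : B12.RunParams) : Dag.B11_main (leavesP w P) := by
  obtain ⟨θ, hP, Mstar, ops, ζ, lamW, hθ, hD, -, -, -, hup⟩ := h
  exact b11_main_at_view₁₂B10YZW_of_leaf θ Mstar ops ζ lamW hup (hZ θ hP Mstar ops ζ lamW hθ hD hup) P

/-- **`S_N07 (₁₂CB10YZW)` FROM THE LEAF SLOT, PACKAGE FORM**: the [B11] leaf at `Z11OfRecord F N ζ` for every six-tuple `(θ, h, M⋆, ops, ζ, lamW)` PRESENTING a record gives
`S_N07` (in-edges unused; the slot quantifies over the HIDDEN residual layers — §4 says what the ∀-form costs). [cite: Balaban1985Variational, Thm 1 p.279, Props 2–9 pp.281–309 (bookkeeping)] -/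
theorem s_N07_record₁₂CB10YZW_of_leafSlot
    (hslot : ∀ (F : T4Family) (D : Datum F N) (w : WorldP), IsRecordOfRecord₁₂CB10YZW F N D w →
      ∀ (θ : Stage12Params F N) (hP : θ.Provisos₁₂ F N) (Mstar : ℕ) (ops : OpsY N θ.toStage3Params Mstar) (ζ : ResidZ F N) (lamW : ResidW F N),
        θ.Admissible F N → D = datumOfRecord₁₂ F N θ hP →
          (∀ P, w.up P = upOfRecord₅C F N (θ.view₁₂B10YZW F N Mstar ops ζ lamW) P) → B11Leaf (Z11OfRecord F N ζ)) :
    S_N07 (fun F D w => IsRecordOfRecord₁₂CB10YZW F N D w) :=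
  fun F D w h P => b11_main_of_isRecordOfRecord₁₂CB10YZW_of_slot h (hslot F D w h) P

/-- **`S_N07 (₁₂CB10YZW)` FROM THE LEAF SLOT, BUNDLE FORM** (§4 `b11Leaf_Z11OfRecord_of_s_N07_record₁₂CB10YZW` is the converse; `not_s_N07_record₁₂CB10YZW`: the hypothesis is
REFUTABLE through `ζ.R` — the ∀-form over ₁₂CB10YZW is NOT an N07 target). [cite: Balaban1985Variational, Thm 1 p.279, Props 2–9 pp.281–309 (bookkeeping)] -/
theorem s_N07_record₁₂CB10YZW_of_bundleSlot (hslot : ∀ (F : T4Family) (ζ : ResidZ F N), B11Leaf (Z11OfRecord F N ζ)) :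
    S_N07 (fun F D w => IsRecordOfRecord₁₂CB10YZW F N D w) :=
  s_N07_record₁₂CB10YZW_of_leafSlot fun F _ _ _ _ _ _ _ ζ _ _ _ _ => hslot F ζ

/-- **THE REPAIR SHAPE ONE STOREY UP**: `S_N07 Rec` for every `Rec` that refines ₁₂CB10YZW and carries the world's own `b11` leaf at every run — what a FURTHER pin (`R` from
genuine cubes, F8; Theorem 1 PROVED at objects — or §3's inputs at the presenting layer) supplies. [cite: Balaban1985Variational, Thm 1 p.279, Props 2–9 pp.281–309 (bookkeeping: the pinned socket)] -/
theorem s_N07_of_refines₁₂CB10YZW_of_leaf (Rec : RecordPred N)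
    (href : ∀ (F : T4Family) (D : Datum F N) (w : WorldP), Rec F D w → IsRecordOfRecord₁₂CB10YZW F N D w)
    (hleaf : ∀ (F : T4Family) (D : Datum F N) (w : WorldP), Rec F D w → ∀ P : B12.RunParams, (leavesP w P).b11) : S_N07 Rec :=
  fun F D w hR P => (b11_main_iff_leaves_of_isRecordOfRecord₁₂CB10YZW (href F D w hR) P).2 fun _ _ => hleaf F D w hR P

/-- **THE REPAIR SHAPE WITH THE PRESENTING PACKAGE DISPLAYED**: `S_N07 Rec` when every `Rec`-record is PRESENTED by a four-pin Stage-12 package `(θ, h, M⋆, ops, ζ, lamW)` (the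
clauses of `IsRecordOfRecord₁₂CB10YZW` verbatim) whose [B11] layer carries the leaf — the socket §3 feeds. [cite: Balaban1985Variational, Thm 1 p.279, Props 2–9 pp.281–309 (bookkeeping: the pinned socket, package form)] -/
theorem s_N07_of_presented₁₂CB10YZW_of_leaf (Rec : RecordPred N)
    (hpres : ∀ (F : T4Family) (D : Datum F N) (w : WorldP), Rec F D w →
      ∃ (θ : Stage12Params F N) (h : θ.Provisos₁₂ F N) (Mstar : ℕ) (ops : OpsY N θ.toStage3Params Mstar) (ζ : ResidZ F N) (lamW : ResidW F N),
        θ.Admissible F N ∧ D = datumOfRecord₁₂ F N θ h ∧ w.C = D.C ∧ (0 < w.γ ∧ w.γ ≤ θ.γ) ∧ w.L = (θ.L : ℝ) ∧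
          (∀ P, w.up P = upOfRecord₅C F N (θ.view₁₂B10YZW F N Mstar ops ζ lamW) P) ∧ B11Leaf (Z11OfRecord F N ζ)) :
    S_N07 Rec := by
  intro F D w hR P
  obtain ⟨θ, h, Mstar, ops, ζ, lamW, -, -, -, -, -, hup, hleaf⟩ := hpres F D w hR
  exact b11_main_at_view₁₂B10YZW_of_leaf θ Mstar ops ζ lamW hup hleaf P

/-- **WHAT `S_N07 Rec` FEEDS THE STAGE-₈ LAYER** for `Rec` refining ₁₂CB10YZW: at every `Rec`-record and run whose in-edges `b8`, `b9` hold, def-B's letters `UkExistsR ∧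
UniqueUkOrbitR F N (regB11 F N)` (every torus, `k ≤ K`, radius `B₃ε₁`, `0 < ε₁ ≤ a₁`, `V` with (7)). [cite: Balaban1985Variational, Thm 1 p.279; Balaban1987RG1, (1.1)–(1.2) p.260] -/
theorem G8a_of_s_N07_refines₁₂CB10YZW (Rec : RecordPred N)
    (href : ∀ (F : T4Family) (D : Datum F N) (w : WorldP), Rec F D w → IsRecordOfRecord₁₂CB10YZW F N D w)
    (hS : S_N07 Rec) (hR : Rec F D w) {P : B12.RunParams} (h8 : (leavesP w P).b8) (h9 : (leavesP w P).b9) :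
    ∃ C : B11Thm1.Consts, ∀ (K k : ℕ), k ≤ K → ∀ ε₁ : ℝ, 0 < ε₁ → ε₁ ≤ C.a₁ → ∀ V : GaugeField (F.P K) k (SU N), PlaqSmall ε₁ V →
      UkExistsR F N (regB11 F N) K k (C.B₃ * ε₁) V ∧ UniqueUkOrbitR F N (regB11 F N) K k (C.B₃ * ε₁) V :=
  G8a_of_leaf_b11_of_isRecordOfRecord₁₂CB10YZW (href F D w hR)
    ((b11_main_iff_leaves_of_isRecordOfRecord₁₂CB10YZW (href F D w hR) P).1 (hS F D w hR P) h8 h9)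

/-! ## §3 The ∃-currency at Stage 12 — the located fix: real runs (modulo K0′), NOT ex falso -/

/-- **THE ∃-DIRECTION AT THE ₁₂ CARRIER RECORD**: for every admissible Stage-12 parameter with provisos and `γ > 0`, every floor, operator layer and [IV] layer, and a residual [B11] layer
`ζ` CARRYING THE LEAF, there is a record of `Node00.IsRecordOfRecord₁₂CB10YZW` over the Stage-12 datum at every run of which N07 HOLDS (the world bound to the four-pin view presenting
`ζ` at `γw := θ.γ`; g33's `exists_world_isRecordOfRecord₁₂CB10YZW` construction, n07-d's ₁₁ recipe).  The binder `(θ, h, hθ)` is the route's K0′ — OPEN, not refuted — so this is a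
statement about REAL runs, unlike its ₁₁ twin (p₁₁). [cite: Balaban1985Variational, Thm 1 p.279, Props 2–9 pp.281–309 (bookkeeping: the node at the ₁₂ record)] -/
theorem exists_record₁₂CB10YZW_b11_main_of_leaf (θ : Stage12Params F N) (h : θ.Provisos₁₂ F N) (hθ : θ.Admissible F N) (hγ : 0 < θ.γ) (Mstar : ℕ)
    (ops : OpsY N θ.toStage3Params Mstar) (ζ : ResidZ F N) (lamW : ResidW F N) (hleaf : B11Leaf (Z11OfRecord F N ζ)) :
    ∃ w : WorldP, IsRecordOfRecord₁₂CB10YZW F N (datumOfRecord₁₂ F N θ h) w ∧ ∀ P : B12.RunParams, Dag.B11_main (leavesP w P) := by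
  obtain ⟨w₀, -, -⟩ := exists_world_isRecordOfRecord₁₂C F N θ h hθ (γw := θ.γ) ⟨hγ, le_rfl⟩
  refine ⟨{ w₀ with
      C := (datumOfRecord₁₂ F N θ h).C, γ := θ.γ, L := (θ.L : ℝ), one_lt_L := by exact_mod_cast θ.hL.2,
      up := fun P => upOfRecord₅C F N (θ.view₁₂B10YZW F N Mstar ops ζ lamW) P },
    ⟨θ, h, Mstar, ops, ζ, lamW, hθ, rfl, rfl, ⟨hγ, le_rfl⟩, rfl, fun _ => rfl⟩, fun P => ?_⟩
  exact b11_main_at_view₁₂B10YZW_of_leaf θ Mstar ops ζ lamW (fun _ => rfl) hleaf P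

/-- **THE STAGE-12 CONSUMER AT THE CRIT-PINNED LAYER, PRINT's PROP-7 DAG** — Props 2–7, 9 + r08's located leaves of Sect. F at `ζ.pinCrit` (this lineage's
`b11Leaf_Z11OfRecord_pinCrit_of_prop7_leaves`: Prop 8 by the halving iteration over the first case with the repaired (166′), (169) with `B₄ = 9dL²B₂B₃`, then
`B11.thm1_of_prop7_prop8_sectF`; «minimal ⇒ critical» a THEOREM at the pin, the restriction law eliminated — NO `hloc`, NO `hcrit`) ⇒ N07 HOLDS at every run of a ₁₂CB10YZW record
over `datumOfRecord₁₂ θ h` presented with the layer `ζ.pinCrit`.  ∃-currency at a NAMED layer of a real Stage-12 run; NOT a discharge.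
[cite: Balaban1985Variational, Thm 1 p.279, Props 2–9 pp.281–309, Prop. 8 p.304, Sect. F (144)–(169) pp.300–305] -/
theorem exists_record₁₂CB10YZW_b11_main_pinCrit_of_prop7_leaves (θ : Stage12Params F N) (h : θ.Provisos₁₂ F N) (hθ : θ.Admissible F N)
    (hγ : 0 < θ.γ) (Mstar : ℕ) (ops : OpsY N θ.toStage3Params Mstar) (lamW : ResidW F N) (ζ : ResidZ F N)
    (Dc : ∀ i : ZIdx, CubeData (famXOfRecord F N ζ.pinCrit i))
    {d L B₂ K R₁M₁ a₃ a₄ : ℝ} (hLv : ∀ i, Leaves (famXOfRecord F N ζ.pinCrit i) (Dc i) d L ζ.B₁ B₂ ζ.B₃ K R₁M₁ ζ.c₁ a₃ a₄)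
    (hd : 1 ≤ d) (hL : 0 < L) (hB₂ : 0 < B₂) (hK : 0 < K) (hR : 1 ≤ R₁M₁) (ha₃ : 0 < a₃) (ha₄ : 0 < a₄)
    (hB₁ : 0 < ζ.B₁) (hB₃ : 0 < ζ.B₃) (hC₁ : 0 < ζ.C₁) (hc₁ : 0 < ζ.c₁)
    (p2 : B11.Prop2Printed ζ.B₁ ζ.B₃ ζ.C₁ ζ.c₁ ζ.famLG) (p3 : B11.Prop3Printed ζ.C₁ ζ.B₃ ζ.C₂ ζ.C₃ ζ.B₀ ζ.c1h ζ.c₄ ζ.δ₀ ζ.famLG)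
    (p4 : B11.Prop4Printed ζ.C₁ ζ.B₃ ζ.famLG) (p5 : B11.Prop5Printed ζ.B₁ ζ.B₃ ζ.C₁ ζ.famLG) (p6 : B11.Prop6Printed ζ.B₀ ζ.B₃ ζ.C₁ ζ.famLG)
    (p7 : B11.Prop7Printed ζ.B₃ ζ.C₁ (famXOfRecord F N ζ.pinCrit)) (p9 : B11.Prop9Printed ζ.B₅ ζ.C₁ ζ.β₀ ζ.δ₀ ζ.famAn) :
    ∃ w : WorldP, IsRecordOfRecord₁₂CB10YZW F N (datumOfRecord₁₂ F N θ h) w ∧ ∀ P : B12.RunParams, Dag.B11_main (leavesP w P) :=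
  exists_record₁₂CB10YZW_b11_main_of_leaf θ h hθ hγ Mstar ops ζ.pinCrit lamW
    (b11Leaf_Z11OfRecord_pinCrit_of_prop7_leaves ζ Dc hLv hd hL hB₂ hK hR ha₃ ha₄ hB₁ hB₃ hC₁ hc₁ p2 p3 p4 p5 p6 p7 p9)

/-- **THE STAGE-12 CONSUMER AT THE CRIT-PINNED LAYER, REPAIRED-TOWER CURRENCY** — the tower parts (Props 2, 5, 6 over `ζ.famLG`, Prop 8 + Sect. F over `famXOfRecord F N ζ.pinCrit` at
`B₃`, the located bridge steps `β bg hbg14 laws leaves` = (15)–(18) p. 280 ∕ (112)–(142) pp. 294–299, the constant relations) + the leaf's own Props 2–6, 8, Sect. F at `ζ.B₃ = B₃κ₀`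
and Prop. 9 (this lineage's `b11Leaf_Z11OfRecord_pinCrit_of_towerT_parts`: `t1` and `p7` DERIVED by the repaired Sect.-A induction on seat -d's tower of record; NO `hloc`, NO
`hcrit`) ⇒ N07 HOLDS at every run of a ₁₂CB10YZW record over `datumOfRecord₁₂ θ h` presented with `ζ.pinCrit`.  ∃-currency at a NAMED layer; NOT a discharge.
[cite: Balaban1985Variational, Thm 1 p.279, Sect. A (11)–(14) pp.279–280, Props 2–9 pp.281–309] -/
theorem exists_record₁₂CB10YZW_b11_main_pinCrit_of_towerT_parts (θ : Stage12Params F N) (h : θ.Provisos₁₂ F N) (hθ : θ.Admissible F N)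
    (hγ : 0 < θ.γ) (Mstar : ℕ) (ops : OpsY N θ.toStage3Params Mstar) (lamW : ResidW F N) (ζ : ResidZ F N)
    (β : ∀ i : ZIdx, Bridge (famXOfRecord F N ζ.pinCrit i) (ζ.famLG i)) (bg : ∀ i : ZIdx, GaugeField (F.P i.K) 0 (SU N) → (ζ.famLG i).Cfg)
    {κ₀ B₃ O₁ O₂ e₅ : ℝ}
    (hbg14 : ∀ (i : ZIdx) (ε : ℝ) (V : GaugeField (F.P i.K) i.k (SU N)) (U : GaugeField (F.P i.K) 0 (SU N)),
      InUkClassB11 F N i.K i.k (ζ.C₁ * B₃ * ε) U → Averaging.iter (avOfRecord F N i.K) i.k U = V →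
        (ζ.famLG i).Sat14 (ζ.C₁ * B₃ * ε) (ζ.C₁ * ε) ((β i).bdry V) (bg i U))
    (laws : ∀ i, (β i).Laws ζ.C₁ B₃) (leaves : ∀ i, ExistenceLeavesCap (β i) ζ.B₀ B₃ ζ.C₁ O₁ O₂ e₅)
    (hκ₀ : 1 ≤ κ₀) (hB₀ : 0 < ζ.B₀) (hB₁ : 0 < ζ.B₁) (hB₃ : 1 ≤ B₃) (hC₁L : (F.L : ℝ) ^ 3 ≤ ζ.C₁) (hB₀B₁ : ζ.B₀ ≤ 4 * ζ.B₁)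
    (hc₁ : 0 < ζ.c₁) (hO₁ : 0 < O₁) (hO₂ : 0 < O₂) (he₅ : 0 < e₅)
    (p2 : B11.Prop2Printed ζ.B₁ B₃ ζ.C₁ ζ.c₁ ζ.famLG) (p5 : B11.Prop5Printed ζ.B₁ B₃ ζ.C₁ ζ.famLG) (p6 : B11.Prop6Printed ζ.B₀ B₃ ζ.C₁ ζ.famLG)
    (p8 : B11.Prop8Printed B₃ (famXOfRecord F N ζ.pinCrit)) (sF : B11.SectFPrinted B₃ (famXOfRecord F N ζ.pinCrit))
    (hζ : ζ.B₃ = B₃ * κ₀)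
    (q2 : B11.Prop2Printed ζ.B₁ ζ.B₃ ζ.C₁ ζ.c₁ ζ.famLG) (q3 : B11.Prop3Printed ζ.C₁ ζ.B₃ ζ.C₂ ζ.C₃ ζ.B₀ ζ.c1h ζ.c₄ ζ.δ₀ ζ.famLG)
    (q4 : B11.Prop4Printed ζ.C₁ ζ.B₃ ζ.famLG) (q5 : B11.Prop5Printed ζ.B₁ ζ.B₃ ζ.C₁ ζ.famLG) (q6 : B11.Prop6Printed ζ.B₀ ζ.B₃ ζ.C₁ ζ.famLG)
    (q8 : B11.Prop8Printed ζ.B₃ (famXOfRecord F N ζ.pinCrit)) (qF : B11.SectFPrinted ζ.B₃ (famXOfRecord F N ζ.pinCrit))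
    (p9 : B11.Prop9Printed ζ.B₅ ζ.C₁ ζ.β₀ ζ.δ₀ ζ.famAn) :
    ∃ w : WorldP, IsRecordOfRecord₁₂CB10YZW F N (datumOfRecord₁₂ F N θ h) w ∧ ∀ P : B12.RunParams, Dag.B11_main (leavesP w P) :=
  exists_record₁₂CB10YZW_b11_main_of_leaf θ h hθ hγ Mstar ops ζ.pinCrit lamW
    (b11Leaf_Z11OfRecord_pinCrit_of_towerT_parts ζ β bg hbg14 laws leaves hκ₀ hB₀ hB₁ hB₃ hC₁L hB₀B₁ hc₁ hO₁ hO₂ he₅ p2 p5 p6 p8 sF hζ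
      q2 q3 q4 q5 q6 q8 qF p9)

section Doubly

variable {L : ℝ} {η : ZIdx → ℝ} [Fact (0 < L)] [∀ i, Fact (0 < η i)] {β : ZIdx → Type} [∀ i, Fintype (β i)]

/-- **THE STAGE-12 CONSUMER AT THE DOUBLY-PINNED LAYER `(ζ.withSectE E).pinCrit`** — the SEVEN printed statements Props 2, 3, 5 (over node00-def-B11's Sect.-E family), Props 7, 8,
Sect. F (over the Props 7–8 family, «critical» = print's), Prop. 9, and the positivity of the letters (this lineage's `b11Leaf_Z11OfRecord_withSectE_pinCrit_of_parts`: `t1` by p. 304's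
assembly, p4∕p6 THEOREMS by `CarriersZSectE`, `hcrit` a theorem, no `hloc`) ⇒ N07 HOLDS at every run of a ₁₂CB10YZW record over `datumOfRecord₁₂ θ h` presented with that layer.
∃-currency at a NAMED layer; NOT a discharge. [cite: Balaban1985Variational, Thm 1 p.279, Props 2–9 pp.281–309] -/
theorem exists_record₁₂CB10YZW_b11_main_withSectE_pinCrit_of_parts (θ : Stage12Params F N) (h : θ.Provisos₁₂ F N) (hθ : θ.Admissible F N)
    (hγ : 0 < θ.γ) (Mstar : ℕ) (ops : OpsY N θ.toStage3Params Mstar) (lamW : ResidW F N) (ζ : ResidZ F N) (E : SectEPres F N L η β ζ)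
    (hC₄ : 0 < E.C₄) (ha₃ : 0 < E.a₃) (hα : 0 < E.α) (hB₀ : 0 < ζ.B₀) (hB₃ : 0 < ζ.B₃) (hC₁ : 0 < ζ.C₁)
    (p2 : B11.Prop2Printed ζ.B₁ ζ.B₃ ζ.C₁ ζ.c₁ (ζ.withSectE E).famLG) (p3 : B11.Prop3Printed ζ.C₁ ζ.B₃ ζ.C₂ ζ.C₃ ζ.B₀ ζ.c1h ζ.c₄ ζ.δ₀ (ζ.withSectE E).famLG)
    (p5 : B11.Prop5Printed ζ.B₁ ζ.B₃ ζ.C₁ (ζ.withSectE E).famLG)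
    (p7 : B11.Prop7Printed ζ.B₃ ζ.C₁ (famXOfRecord F N (ζ.withSectE E).pinCrit)) (p8 : B11.Prop8Printed ζ.B₃ (famXOfRecord F N (ζ.withSectE E).pinCrit))
    (sF : B11.SectFPrinted ζ.B₃ (famXOfRecord F N (ζ.withSectE E).pinCrit)) (p9 : B11.Prop9Printed ζ.B₅ ζ.C₁ ζ.β₀ ζ.δ₀ ζ.famAn) :
    ∃ w : WorldP, IsRecordOfRecord₁₂CB10YZW F N (datumOfRecord₁₂ F N θ h) w ∧ ∀ P : B12.RunParams, Dag.B11_main (leavesP w P) :=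
  exists_record₁₂CB10YZW_b11_main_of_leaf θ h hθ hγ Mstar ops _ lamW
    (b11Leaf_Z11OfRecord_withSectE_pinCrit_of_parts ζ E hC₄ ha₃ hα hB₀ hB₃ hC₁ p2 p3 p5 p7 p8 sF p9)

/-- ★ **THE STAGE-12 CONSUMER IN THE PRINTED-TOWER CURRENCY (κ₀ = 1) AT THE DOUBLY-PINNED LAYER** — Props 2, 3, 5 (Sect.-E family), Prop 8 + Sect. F (Props 7–8 family at the ONE
constant `ζ.B₃`), Prop. 9, the located bridge steps `βr bg hbg14 laws leaves` ((15)–(18), (112)–(142)), `B₀ ≤ 4B₁`, `B₃ ≥ 1`, `C₁ ≥ L³`, the letters' positivity (this lineage's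
`b11Leaf_Z11OfRecord_withSectE_pinCrit_of_towerT_parts_kappa_one`: Theorem 1 AND Proposition 7 DERIVED by the repaired Sect.-A induction, p4∕p6 theorems, `hcrit` a theorem, Sect. A and
the whole dictionary PROVED) ⇒ N07 HOLDS at every run of a ₁₂CB10YZW record over `datumOfRecord₁₂ θ h` presented with `(ζ.withSectE E).pinCrit`.  The N07 node sentence of record in
the s3 currency, now about REAL Stage-12 runs (modulo K0′); NOT a discharge (junk in-edges at the presenting world; every printed statement displayed).
[cite: Balaban1985Variational, Thm 1 p.279, Sect. A (11)–(14) pp.279–280, Props 2–9 pp.281–309] -/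
theorem exists_record₁₂CB10YZW_b11_main_withSectE_pinCrit_of_towerT_parts_kappa_one (θ : Stage12Params F N) (h : θ.Provisos₁₂ F N)
    (hθ : θ.Admissible F N) (hγ : 0 < θ.γ) (Mstar : ℕ) (ops : OpsY N θ.toStage3Params Mstar) (lamW : ResidW F N) (ζ : ResidZ F N)
    (E : SectEPres F N L η β ζ) (hC₄ : 0 < E.C₄) (ha₃ : 0 < E.a₃) (hα : 0 < E.α)
    (βr : ∀ i : ZIdx, Bridge (famXOfRecord F N (ζ.withSectE E).pinCrit i) ((ζ.withSectE E).famLG i))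
    (bg : ∀ i : ZIdx, GaugeField (F.P i.K) 0 (SU N) → ((ζ.withSectE E).famLG i).Cfg) {O₁ O₂ e₅ : ℝ}
    (hbg14 : ∀ (i : ZIdx) (ε : ℝ) (V : GaugeField (F.P i.K) i.k (SU N)) (U : GaugeField (F.P i.K) 0 (SU N)),
      InUkClassB11 F N i.K i.k (ζ.C₁ * ζ.B₃ * ε) U → Averaging.iter (avOfRecord F N i.K) i.k U = V →
        ((ζ.withSectE E).famLG i).Sat14 (ζ.C₁ * ζ.B₃ * ε) (ζ.C₁ * ε) ((βr i).bdry V) (bg i U))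
    (laws : ∀ i, (βr i).Laws ζ.C₁ ζ.B₃) (leaves : ∀ i, ExistenceLeavesCap (βr i) ζ.B₀ ζ.B₃ ζ.C₁ O₁ O₂ e₅)
    (hB₀ : 0 < ζ.B₀) (hB₁ : 0 < ζ.B₁) (hB₃ : 1 ≤ ζ.B₃) (hC₁L : (F.L : ℝ) ^ 3 ≤ ζ.C₁) (hB₀B₁ : ζ.B₀ ≤ 4 * ζ.B₁)
    (hc₁ : 0 < ζ.c₁) (hO₁ : 0 < O₁) (hO₂ : 0 < O₂) (he₅ : 0 < e₅)
    (p2 : B11.Prop2Printed ζ.B₁ ζ.B₃ ζ.C₁ ζ.c₁ (ζ.withSectE E).famLG) (p3 : B11.Prop3Printed ζ.C₁ ζ.B₃ ζ.C₂ ζ.C₃ ζ.B₀ ζ.c1h ζ.c₄ ζ.δ₀ (ζ.withSectE E).famLG)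
    (p5 : B11.Prop5Printed ζ.B₁ ζ.B₃ ζ.C₁ (ζ.withSectE E).famLG)
    (p8 : B11.Prop8Printed ζ.B₃ (famXOfRecord F N (ζ.withSectE E).pinCrit)) (sF : B11.SectFPrinted ζ.B₃ (famXOfRecord F N (ζ.withSectE E).pinCrit))
    (p9 : B11.Prop9Printed ζ.B₅ ζ.C₁ ζ.β₀ ζ.δ₀ ζ.famAn) :
    ∃ w : WorldP, IsRecordOfRecord₁₂CB10YZW F N (datumOfRecord₁₂ F N θ h) w ∧ ∀ P : B12.RunParams, Dag.B11_main (leavesP w P) :=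
  exists_record₁₂CB10YZW_b11_main_of_leaf θ h hθ hγ Mstar ops _ lamW
    (b11Leaf_Z11OfRecord_withSectE_pinCrit_of_towerT_parts_kappa_one ζ E hC₄ ha₃ hα βr bg hbg14 laws leaves hB₀ hB₁ hB₃ hC₁L hB₀B₁ hc₁
      hO₁ hO₂ he₅ p2 p3 p5 p8 sF p9)

end Doubly

/-- ★ **THE ∃-FORM OF THE (B)-SIDE CRUX SERVED AT THE PIN (N07's conjunct)**: if the Stage-12 record class is inhabited at the family `F` (the route's K0′ `Record12Inhabited` at this
family — `∃ D w, IsRecordOfRecord₁₂C F N D w` —, HYPOTHESIS) and the [B11] leaf holds at the bundle of record of SOME residual layer `ζ` (e.g. §3's named layers from their displayed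
printed inputs), then SOME ₁₂C record `(D, w′)` — the given datum `D`, its world RE-BOUND by the four-pin view presenting `ζ` (g33's `isRecordOfRecord₁₂CB10YZW_rebind_of_isRecordOfRecord₁₂C`;
floor `0`, n22-b's junk operator layer, any [IV] layer — any layers would do) — is a ₁₂CB10YZW record AND carries `Dag.B11_main` at every run.  N07 ALONE; the other twelve conjuncts of
K1′'s `stub_nodes12` are the sister seats' (n08-c's `exists_isRecordOfRecord₁₂C_b10_main_of_printedUV3V` is the N08 twin). [cite: Balaban1985Variational, Thm 1 p.279, Props 2–9 pp.281–309; Balaban1989LargeFieldII, Thm 1 + (0.1) pp.355–356 (bookkeeping)] -/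
theorem exists_isRecordOfRecord₁₂C_b11_main_of_leaf (F : T4Family) (hK0 : ∃ (D : Datum F N) (w : WorldP), IsRecordOfRecord₁₂C F N D w)
    (ζ : ResidZ F N) (hleaf : B11Leaf (Z11OfRecord F N ζ)) :
    ∃ (D : Datum F N) (w : WorldP), IsRecordOfRecord₁₂C F N D w ∧ IsRecordOfRecord₁₂CB10YZW F N D w ∧ ∀ P : B12.RunParams, Dag.B11_main (leavesP w P) := by
  obtain ⟨D, w, h⟩ := hK0
  obtain ⟨θ, _, hθ, -, h12⟩ := isRecordOfRecord₁₂CB10YZW_rebind_of_isRecordOfRecord₁₂C h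
  obtain ⟨ops, -, -⟩ := exists_junkOps_b9LeafX_Y9OfRecord (N := N) θ.toStage3Params hθ.1.1.1.1.1 0
  obtain ⟨lamW⟩ := nonempty_residW F N
  exact ⟨D, _, isRecordOfRecord₁₂C_of_isRecordOfRecord₁₂CB10YZW (h12 0 ops ζ lamW), h12 0 ops ζ lamW,
    b11_main_at_view₁₂B10YZW_of_leaf θ 0 ops ζ lamW (fun _ => rfl) hleaf⟩

/-! ## §4 Census ∕ guards at ₁₂CB10YZW — the junk channel `ζ.R` survives the Stage-12 repair (g33: «the ∀-forms stay junk-able as at ₁₁»), certified for N07 -/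

/-- **A ₁₂CB10YZW WORLD PRESENTED BY A GIVEN OPERATOR LAYER, [B11] LAYER AND [IV] LAYER, in-edge `b8` VACUOUS**: every admissible Stage-12 `θ` with its provisos and `γ > 0`, ANY floor,
`ops`, `ζ`, `lamW` present a ₁₂CB10YZW record over the SAME datum `datumOfRecord₁₂ θ h` ([B8] indices RE-BOUND EMPTY by g32's `Stage12Params.rebindX` — `Provisos₁₂.rebindX`,
`datumOfRecord₁₂_rebindX`; `B11LeafUnpinnedRecord.b8LeafR_of_isEmpty`) at every run of which `b8` HOLDS, `b9 ↔ B9LeafX (Y9OfRecord N θ₃ M⋆ ops)`, `b11 ↔ B11Leaf (Z11OfRecord F N ζ)`.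
[cite: Balaban1985Variational, Thm 1 p.279; Balaban1985BackgroundPropagators, Thm 3.1 p.397; Balaban1985RegularSpaces, Lemma 1 – Thm 8 pp.79–101 (bookkeeping: the record's faces)] -/
theorem exists_record₁₂CB10YZW_faces (θ : Stage12Params F N) (h : θ.Provisos₁₂ F N) (hθ : θ.Admissible F N) (hγ : 0 < θ.γ) (Mstar : ℕ)
    (ops : OpsY N θ.toStage3Params Mstar) (ζ : ResidZ F N) (lamW : ResidW F N) :
    ∃ w : WorldP, IsRecordOfRecord₁₂CB10YZW F N (datumOfRecord₁₂ F N θ h) w ∧ ∀ P : B12.RunParams,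
      (leavesP w P).b8 ∧ ((leavesP w P).b9 ↔ B9LeafX (Y9OfRecord N θ.toStage3Params Mstar ops)) ∧
        ((leavesP w P).b11 ↔ B11Leaf (Z11OfRecord F N ζ)) := by
  let X' : B12.RunParams → PrintedCarriersR := fun P =>
    { θ.res.X P with
      I8a := PEmpty, I8b := PEmpty, I8c := PEmpty, I8d := PEmpty, loc8 := fun i => i.elim, fam8 := fun i => i.elim,
      lan8 := fun i => i.elim, cub8 := fun i => i.elim, toAxial8 := fun i => i.elim, C140 := fun i => i.elim, InR := fun i => i.elim,
      proj140 := fun i => i.elim }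
  let θ' : Stage12Params F N := θ.rebindX F N X'
  have h' : θ'.Provisos₁₂ F N := h.rebindX X'
  have hθ' : θ'.Admissible F N := hθ  -- `rfl`: admissibility reads no carrier (n08-c's `N08AtRecord12Sides.admissible_rebindX_iff`)
  have hD : datumOfRecord₁₂ F N θ' h' = datumOfRecord₁₂ F N θ h := datumOfRecord₁₂_rebindX F N θ h X' h'
  obtain ⟨w₀⟩ := nonempty_worldP
  refine ⟨{ w₀ with
      C := (datumOfRecord₁₂ F N θ' h').C, γ := θ.γ, L := (θ.L : ℝ), one_lt_L := by exact_mod_cast θ.hL.2,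
      up := fun P => upOfRecord₅C F N (θ'.view₁₂B10YZW F N Mstar ops ζ lamW) P }, ?_, fun P => ?_⟩
  · rw [← hD]
    exact ⟨θ', h', Mstar, ops, ζ, lamW, hθ', rfl, rfl, ⟨hγ, le_rfl⟩, rfl, fun _ => rfl⟩
  · have hl := upOfRecord₅C_view₁₂B10YZW_leaves F N θ' Mstar ops ζ lamW P
    refine ⟨?_, hl.2.1, hl.2.2.2⟩
    exact (B11LeafUnpinnedRecord.upOfRecord₅C_b8_b9_b11 (θ'.view₁₂B10YZW F N Mstar ops ζ lamW) P).1.2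
      (@B11LeafUnpinnedRecord.b8LeafR_of_isEmpty _ _ _ _ (inferInstance : IsEmpty PEmpty) (inferInstance : IsEmpty PEmpty)
        (inferInstance : IsEmpty PEmpty) (inferInstance : IsEmpty PEmpty) _ _ _ _ _ _ _ _ _ _ _ _ _ _ _)

/-- **THE ∀-FORM FORCES THE [B11] LEAF AT THE BUNDLE OF RECORD OF EVERY RESIDUAL LAYER** (converse of `s_N07_record₁₂CB10YZW_of_bundleSlot` up to the window clause): at the record of
`exists_record₁₂CB10YZW_faces` with n22-b's JUNK operator layer and any [IV] layer (`nonempty_residW`) the in-edges hold, so N07 there IS the leaf. [cite: Balaban1985Variational, Thm 1 p.279 (bookkeeping)] -/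
theorem b11Leaf_Z11OfRecord_of_s_N07_record₁₂CB10YZW (hS : S_N07 (fun F D w => IsRecordOfRecord₁₂CB10YZW F N D w))
    (θ : Stage12Params F N) (h : θ.Provisos₁₂ F N) (hθ : θ.Admissible F N) (hγ : 0 < θ.γ) (ζ : ResidZ F N) : B11Leaf (Z11OfRecord F N ζ) := by
  obtain ⟨ops, -, hops⟩ := exists_junkOps_b9LeafX_Y9OfRecord (N := N) θ.toStage3Params hθ.1.1.1.1.1 0
  obtain ⟨lamW⟩ := nonempty_residW F N
  obtain ⟨w, hw, hl⟩ := exists_record₁₂CB10YZW_faces θ h hθ hγ 0 ops ζ lamW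
  let P₀ : B12.RunParams := ⟨0, 0, 0⟩
  obtain ⟨h8, h9, h11⟩ := hl P₀
  exact h11.1 ((b11_main_iff_leaves_of_isRecordOfRecord₁₂CB10YZW hw P₀).1 (hS F _ w hw P₀) h8 (h9.2 hops))

/-- **… HENCE THE ∀-FORM ASSERTS THEOREM 1 AT NODE 00's OBJECTS FOR EVERY RESIDUAL REGULARITY DATUM `R`** — degenerate data included, which is absurd (next theorem). [cite: Balaban1985Variational, Thm 1 (9)–(10) p.279 (bookkeeping: the typed regularity clause reads residual data)] -/
theorem thm1_family_of_s_N07_record₁₂CB10YZW (hS : S_N07 (fun F D w => IsRecordOfRecord₁₂CB10YZW F N D w))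
    (θ : Stage12Params F N) (h : θ.Provisos₁₂ F N) (hθ : θ.Admissible F N) (hγ : 0 < θ.γ) (R : ∀ i : ZIdx, RegCarrierT F N i.K) :
    ∃ C : B11Thm1.Consts, ∀ i : ZIdx, Thm1At C (varProblemT F N i.K i.k (R i)) := by
  obtain ⟨ζ₀⟩ := nonempty_residZ F N
  exact exists_thm1At_of_b11Leaf_Z11OfRecord (b11Leaf_Z11OfRecord_of_s_N07_record₁₂CB10YZW hS θ h hθ hγ { ζ₀ with R := R })

/-- **`S_N07` AT `Rec := IsRecordOfRecord₁₂CB10YZW` IS FALSE as soon as ONE admissible Stage-12 parameter with its provisos and `γ > 0` exists** — i.e. MODULO the route's K0′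
`Record12Inhabited` (open; at ₁₂ neither ex falso nor assumed here) — through g30's refuting residual layer `exists_residZ_not_b11Leaf`: K1′'s knit must NOT instantiate `S_N07` at the
four-pin key in ∀-form; the junk channel is the residual regularity datum `ζ.R` (F8 — the next object-level pin, node00-def-B11's row), NOT the criticality slot (pinned, g2) nor the
Sect.-E family (presented, node00-def-B11 g2). [cite: Balaban1985Variational, Thm 1 p.279 (bookkeeping: the universal form over the cumulative record is refutable through the residual layer)] -/
theorem not_s_N07_record₁₂CB10YZW_of_params (θ : Stage12Params F N) (h : θ.Provisos₁₂ F N) (hθ : θ.Admissible F N) (hγ : 0 < θ.γ) :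
    ¬ S_N07 (fun F D w => IsRecordOfRecord₁₂CB10YZW F N D w) := fun hS => by
  obtain ⟨ζ, hζ⟩ := exists_residZ_not_b11Leaf F N
  exact hζ (b11Leaf_Z11OfRecord_of_s_N07_record₁₂CB10YZW hS θ h hθ hγ ζ)

/-- **Given ONE ₁₂CB10YZW record, a ₁₂CB10YZW record over the SAME datum at every run of which `b8`, `b9` HOLD and N07 FAILS** (junk operator layer, refuting residual [B11] layer, empty [B8] indices, the record's own [IV] layer). [cite: Balaban1985Variational, Thm 1 p.279 (bookkeeping over NODE 00's four-pin Stage-12 record)] -/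
theorem exists_record₁₂CB10YZW_not_b11_main (hR : IsRecordOfRecord₁₂CB10YZW F N D w) :
    ∃ w' : WorldP, IsRecordOfRecord₁₂CB10YZW F N D w' ∧ ∀ P : B12.RunParams, ¬ Dag.B11_main (leavesP w' P) := by
  obtain ⟨θ, h, Mstar, -, -, lamW, hθ, hD, -, hγ, -, -⟩ := hR
  obtain ⟨ops, -, hops⟩ := exists_junkOps_b9LeafX_Y9OfRecord (N := N) θ.toStage3Params hθ.1.1.1.1.1 Mstar
  obtain ⟨ζ, hζ⟩ := exists_residZ_not_b11Leaf F N
  obtain ⟨w', hw', hl⟩ := exists_record₁₂CB10YZW_faces θ h hθ (hγ.1.trans_le hγ.2) Mstar ops ζ lamW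
  refine ⟨w', by rw [hD]; exact hw', fun P hN => ?_⟩
  obtain ⟨h8, h9, h11⟩ := hl P
  exact hζ (h11.1 ((b11_main_iff_leaves_of_isRecordOfRecord₁₂CB10YZW hw' P).1 hN h8 (h9.2 hops)))

/-- **`S_N07` at ₁₂CB10YZW is FALSE relative to ONE ₁₂CB10YZW record** (any family; the record certifies `θ`, its provisos, admissibility and `0 < w.γ ≤ θ.γ`; whether such a record EXISTS is the route's K0′ `Record12Inhabited` — not reached for here). [cite: Balaban1985Variational, Thm 1 p.279 (bookkeeping)] -/
theorem not_s_N07_record₁₂CB10YZW (hex : ∃ (F : T4Family) (D : Datum F N) (w : WorldP), IsRecordOfRecord₁₂CB10YZW F N D w) :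
    ¬ S_N07 (fun F D w => IsRecordOfRecord₁₂CB10YZW F N D w) := by
  obtain ⟨F, D, w, θ, h, -, -, -, -, hθ, -, -, hγ, -, -⟩ := hex
  exact not_s_N07_record₁₂CB10YZW_of_params θ h hθ (hγ.1.trans_le hγ.2)

/-- **AT THE JUNK-OPS ∕ EMPTY-[B8] RECORDS N07 IS EXACTLY THE [B11] LEAF AT THE BUNDLE OF RECORD** (every admissible Stage-12 `θ` with provisos and `γ > 0`, every floor, `ζ`, `lamW`).
NOT junk-closable: its `t1` is Theorem 1 at NODE 00's OBJECTS over the inhabited `ZIdx` (`k = 0`: `CarriersZ.famV_levelZero_exists8_unique6`; `k ≥ 1`: Bałaban's theorem, GAPS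
G₈a-1∕2). [cite: Balaban1985Variational, Thm 1 p.279, Props 2–9 pp.281–309] -/
theorem exists_record₁₂CB10YZW_b11_main_iff_leaf (θ : Stage12Params F N) (h : θ.Provisos₁₂ F N) (hθ : θ.Admissible F N) (hγ : 0 < θ.γ)
    (Mstar : ℕ) (ζ : ResidZ F N) (lamW : ResidW F N) :
    ∃ w : WorldP, IsRecordOfRecord₁₂CB10YZW F N (datumOfRecord₁₂ F N θ h) w ∧
      ∀ P : B12.RunParams, Dag.B11_main (leavesP w P) ↔ B11Leaf (Z11OfRecord F N ζ) := by
  obtain ⟨ops, -, hops⟩ := exists_junkOps_b9LeafX_Y9OfRecord (N := N) θ.toStage3Params hθ.1.1.1.1.1 Mstar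
  obtain ⟨w, hw, hl⟩ := exists_record₁₂CB10YZW_faces θ h hθ hγ Mstar ops ζ lamW
  refine ⟨w, hw, fun P => ?_⟩
  obtain ⟨h8, h9, h11⟩ := hl P
  rw [b11_main_iff_leaves_of_isRecordOfRecord₁₂CB10YZW hw P, ← h11]
  exact ⟨fun hN => hN h8 (h9.2 hops), fun hb _ _ => hb⟩

end Summit.QuantumFields.YangMills.BalabanUVNodes.N07AtRecord12

end
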